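import Summits.ABC.IUTFork.Cor312Real
import Summits.ABC.IUTFork.LDHWitness
import HarnessLib

/-!
# [IUTchIII] Cor. 3.12 verbatim over the REAL carriers as SCHEMATA (FACT-LIST rows F-2147 `StatementReal`,
# F-2148 `StatementRealDH`): ∀-closures REFUTED, instances INHABITED — at junk SETTINGS with free volume binders

PROOF-ONLY companion (0 `def`, 0 `instance`, 0 notation; the junk c312-7 `Setting`s are built inside the theorem terms) of
the abc-iut cell, block F (seat abc-iut-f-135, gen 8; director-abc g4 ROW SUPPLY `ROWS-LF-0348.tsv` rows 50–51 «decide the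
label»; abc-iut-f-130 g7 residual census, «three L-sized»). It imports — never edits — abc-iut-c312-5's `Cor312Real`
(`Cor312.StatementReal` / `Cor312.StatementRealDH`: c312-7's `Cor312.Setting.Statement` specialised to the real carriers
`Real.situation …` / `situationDH …`, with the (i) (a) admissibility predicate `Adm` and the mono-analytic log-volume `logvol`
FREE binders of the signature) and c312-3's `LDHWitness.exists_pilotData_rat` (pilot data over `ℚ`).

* `Cor312.Setting.exists_setting_statement_iff` — over ANY situation `S` of ANY index skeleton whose line-`0` data admit
  the whole packet with log-volume `0`, and any `b : Prop`, there is a c312-7 `Setting` whose `Statement` holds IFF `b`: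
  all Frobenioid/strip/monoid slots `Unit`, Kummer images of both pilots `= everything`, hull frame `{everything}` whose
  predicate «admits a holomorphic hull» is `:= b` — if `b` fails no `^{n,∘}𝒰_{j,v_ℚ}` is defined, `−|log(Θ)| = +∞` and the
  first printed clause `−|log(Θ)| ∈ ℝ` fails; if `b` holds both printed quantities are the procession-normalised sum of the
  log-volume of the whole packet, i.e. equal (`exists_setting_not_statement`, `exists_setting_statement`).
* `not_forall_statementReal` / `exists_statementReal` (F-2147) and `not_forall_statementRealDH` / `exists_statementRealDH`
  (F-2148): instantiate at pilot data over `ℚ`, zero `p`-adic logarithm branches, all (Ind1)/(Ind2) slots `univ` (resp. the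
  Dupuy–Hilado slots), `Adm := ⊤`, `logvol := 0`, empty (b)/(c) data.

* F-2149 `StatementRealM` (index skeleton = abc-iut-L5-t2's `InitialThetaData`, [IUTchI] Def. 3.1 itself; no closed term of
  that type is junk — none is constructed in the tree): decided PER DATUM — `exists_not_statementRealM D` /
  `exists_statementRealM D` for EVERY `D`; the ∀-closure is thereby refuted modulo `Nonempty (InitialThetaData …)`.

Instance of record at NON-junk volumes (by name, untouched): abc-iut-c312-5's `Thm311.Real.statement_settingDHVolUnit`
(`Cor312SettingDHVolWitness`), a closed setting over `situationDH` with the Dupuy–Hilado volumes at which the statement holds.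

HONEST FRAMING: a refuted ∀-closure says only that the verbatim statement is not a theorem of its FREE signature (free
`Adm`/`logvol`/hull frames/Kummer-image glue) — which nobody claims; the row's content is per-datum ([IUTchIII] Cor. 3.12 at
genuine data, the cell's `Cor312AtDatum` / adjudication). Nothing here bears on [IUTchIII] Thm. 3.11 / Cor. 3.12 at genuine
data, on Dupuy–Hilado, and no side is taken on any author. A FACT row is an assumption label on OUR typed statement;
typed ≠ proved. [claim: Mochizuki2012, status: disputed]
-/

noncomputable section

open Set

namespace Summit.ABC.IUTFork

open Literature.IUT.LogVolume Literature.IUT.LogThetaLattice NumberField IsDedekindDomain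
open Summit.ABC.IUTFork.Thm311

namespace Cor312.Setting

variable {T : ThetaIndex} (S : Situation T)

/-- **The junk setting, parametrised by the frame predicate «admits a holomorphic hull» `:= b`**, over any situation whose
line-`0` data admit the whole packet with log-volume `0`: all Frobenioid/strip/monoid slots `Unit`, both pilots' Kummer
images `= univ`, hull frame `{univ}`. Its verbatim statement holds IFF `b`: if `b` fails no `^{n,∘}𝒰_{j,v_ℚ}` is defined and
`−|log(Θ)| = +∞`; if `b` holds both printed quantities are the procession-normalised sum of `logvol univ = 0`.
[claim: Mochizuki2012, status: disputed] -/
theorem exists_setting_statement_iff (hAdm : ∀ (j : T.Label) (vQ : T.VQ), (S.D 0).Adm j vQ Set.univ)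
    (hvol : ∀ (j : T.Label) (vQ : T.VQ), (S.D 0).logvol j vQ Set.univ = 0) (b : Prop) :
    ∃ P : Setting S, (P.Statement ↔ b) := by
  classical
  -- inhabitants of the index types
  obtain ⟨v₀, -⟩ := T.Vbad_nonempty
  let vQ₀ : T.VQ := T.over v₀
  let i₀ : Fin T.lstar := ⟨0, by have := T.two_le_lstar; omega⟩
  let P : Setting S :=
    { n := 0
      HT := ℤ × ℤ
      LogLink := fun _ _ => Unit
      IsFull := fun _ => True
      lattice :=
        { theater := fun n m => (n, m)
          distinct := fun p q h => by simpa using h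
          logLink := fun _ _ => ()
          logLink_full := fun _ _ => trivial }
      Frd := Unit
      IsoF := fun _ _ => Unit
      Ob := fun _ => Unit
      realify := id
      Strip := Unit
      IsoS := fun _ _ => Unit
      M := fun _ _ => Unit
      sig :=
        { FMOD := fun _ => ()
          Fmod := fun _ => ()
          Ffrak := fun _ => ()
          isoModMOD := fun _ => ()
          isoModFrak := fun _ => ()
          isoFrakMOD := fun _ => ()
          CLGP := ()
          Clgp := ()
          FLGP := ()
          Flgp := ()
          Fgau := ()
          isoGauLGP := ()
          isoLGPlgp := ()
          isoCLGPlgp := ()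
          embLGP := fun _ _ => ()
          embLgp := fun _ _ => ()
          embLGP_injective := fun a b _ => Subsingleton.elim a b
          embLgp_injective := fun a b _ => Subsingleton.elim a b
          objOfLgp := fun _ => ()
          objOfLGP := fun _ => ()
          objOfFrak := fun _ _ => ()
          objOfMOD := fun _ _ => () }
      split :=
        { Msplit := fun _ _ => ⊤
          exists_gen := fun _ _ => ⟨⟨(), trivial⟩, fun x => ⟨1, 1, 0, one_pos, one_pow 1, Subsingleton.elim _ _⟩⟩ }
      ObΔ := Unit
      N := fun _ _ => Unit
      qData :=
        { q := fun _ _ => ()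
          q_gen := fun _ _ => fun x => ⟨1, 1, 0, one_pos, one_pow 1, Subsingleton.elim _ _⟩
          objOf := fun _ => () }
      frame := fun j vQ =>
        { Hul := {Set.univ}
          IsBounded := fun _ => True
          HasHull := fun _ => b
          hul_bounded := fun _ _ => trivial
          bounded_mono := fun _ _ _ _ => trivial
          exists_hul := fun U _ => ⟨Set.univ, Set.mem_singleton _, Set.subset_univ U⟩
          hull_mem := fun U _ _ => by
            rw [Set.mem_singleton_iff, Set.sInter_eq_univ]
            exact fun H hH => Set.mem_singleton_iff.mp hH.1 }
      hul_adm := fun j vQ H hH => by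
        rw [Set.mem_singleton_iff] at hH
        subst hH
        exact hAdm j vQ
      thetaRegionOf := fun _ _ _ _ => Set.univ
      qRegionOf := fun _ _ _ => Set.univ
      qRegion_mem := fun _ _ => Set.mem_singleton _
      qSupport_finite := fun j => by
        have h0 : (fun vQ => (S.D 0).logvol j vQ (Set.univ : Set (S.L.Packet j vQ))) = fun _ => 0 :=
          funext fun vQ => hvol j vQ
        rw [h0]
        simp }
  refine ⟨P, ?_⟩
  by_cases hb : b
  · -- every hull is the whole packet, every local contribution is `logvol univ = 0`
    have hhull : ∀ (j : T.Label) (vQ : T.VQ), P.thetaHull j vQ = Set.univ := by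
      intro j vQ
      show (P.frame j vQ).hull _ = Set.univ
      unfold HullFrame.hull
      rw [if_pos trivial, Set.sInter_eq_univ]
      exact fun H hH => Set.mem_singleton_iff.mp hH.1
    have hloc : ∀ (i : Fin T.lstar) (vQ : T.VQ), P.thetaLocal (labelSucc i) vQ = ((0 : ℝ) : WithTop ℝ) := by
      intro i vQ
      unfold Setting.thetaLocal
      rw [if_pos ⟨trivial, hb⟩, hhull]
      exact congrArg _ (hvol _ _)
    have hfin : P.ThetaFinite := by
      refine ⟨fun i vQ => by rw [hloc]; exact WithTop.coe_ne_top, fun i => ?_⟩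
      have h0 : (fun vQ => (P.thetaLocal (labelSucc i) vQ).untopD 0) = fun _ => 0 := by
        funext vQ; rw [hloc]; rfl
      rw [h0]
      simp
    have hΘ : P.negLogTheta = ((processionNormalized fun _ : Fin T.lstar => (0 : ℝ) : ℝ) : WithTop ℝ) := by
      unfold Setting.negLogTheta
      rw [if_pos hfin]
      congr 1
      congr 1
      funext i
      have h0 : (fun vQ => (P.thetaLocal (labelSucc i) vQ).untopD 0) = fun _ => (0 : ℝ) := by
        funext vQ; rw [hloc]; rfl
      rw [h0, finsum_zero]
    have hQ : P.negLogQ = processionNormalized fun _ : Fin T.lstar => (0 : ℝ) := by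
      unfold Setting.negLogQ
      congr 1
      funext i
      have h0 : (fun vQ => P.qLocal (labelSucc i) vQ) = fun _ => (0 : ℝ) := funext fun vQ => hvol _ _
      rw [h0, finsum_zero]
    refine iff_of_true ⟨?_, ?_⟩ hb
    · rw [hΘ]; exact WithTop.coe_ne_top
    · rw [hΘ, hQ]
  · -- `−|log(Θ)| = +∞`: no union of possible images admits its hull
    have hloc : P.thetaLocal (labelSucc i₀) vQ₀ = ⊤ := by
      unfold Setting.thetaLocal
      rw [if_neg]
      exact fun h => hb h.2
    refine iff_of_false (fun hS => hS.1 ?_) hb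
    unfold Setting.negLogTheta
    rw [if_neg]
    exact fun hfin => hfin.1 i₀ vQ₀ hloc

/-- A junk setting at which the verbatim statement FAILS (`b := False`). [claim: Mochizuki2012, status: disputed] -/
theorem exists_setting_not_statement (hAdm : ∀ (j : T.Label) (vQ : T.VQ), (S.D 0).Adm j vQ Set.univ)
    (hvol : ∀ (j : T.Label) (vQ : T.VQ), (S.D 0).logvol j vQ Set.univ = 0) :
    ∃ P : Setting S, ¬ P.Statement := by
  obtain ⟨P, hP⟩ := exists_setting_statement_iff S hAdm hvol False
  exact ⟨P, fun h => hP.mp h⟩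

/-- A junk setting at which the verbatim statement HOLDS (`b := True`). [claim: Mochizuki2012, status: disputed] -/
theorem exists_setting_statement (hAdm : ∀ (j : T.Label) (vQ : T.VQ), (S.D 0).Adm j vQ Set.univ)
    (hvol : ∀ (j : T.Label) (vQ : T.VQ), (S.D 0).logvol j vQ Set.univ = 0) :
    ∃ P : Setting S, P.Statement := by
  obtain ⟨P, hP⟩ := exists_setting_statement_iff S hAdm hvol True
  exact ⟨P, hP.mpr trivial⟩

end Cor312.Setting

/-! ## F-2147 `Cor312.StatementReal` and F-2148 `Cor312.StatementRealDH` -/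

namespace SchemaClosures

open Cor312

/-- **F-2147, ∀-closure REFUTED**: the verbatim statement over the real carriers is not a theorem of its free signature —
at pilot data over `ℚ` (c312-3's `exists_pilotData_rat`), zero log branches, all (Ind1)/(Ind2) slots `univ`, `Adm := ⊤`,
`logvol := 0`, empty (b)/(c) data, the junk setting of `exists_setting_not_statement` has `−|log(Θ)| = +∞`.
[claim: Mochizuki2012, status: disputed] -/
theorem not_forall_statementReal :
    ¬ ∀ (F : Type) [Field F] [NumberField F] (X : PilotData F) (logv : Real.PadicLogs F)
        (Aut Ism : ∀ x : Real.Place F, Set (Real.Carrier x ≃ₗ[ℚ] Real.Carrier x))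
        (hAut : ∀ x, LinearEquiv.refl ℚ (Real.Carrier x) ∈ Aut x)
        (hIsm : ∀ x, LinearEquiv.refl ℚ (Real.Carrier x) ∈ Ism x)
        (archPk : ∀ (j : (Real.thetaIndex X).Label) (vQ : Real.RatPlace),
          Set ((Real.logShells X logv Aut Ism hAut hIsm).Packet j vQ))
        (archSub : ∀ (j : (Real.thetaIndex X).Label) (v : Real.Place F),
          Set ((Real.logShells X logv Aut Ism hAut hIsm).Packet j ((Real.thetaIndex X).over v)))
        (Adm : ∀ (j : (Real.thetaIndex X).Label) (vQ : Real.RatPlace),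
          Set ((Real.logShells X logv Aut Ism hAut hIsm).Packet j vQ) → Prop)
        (logvol : ∀ (j : (Real.thetaIndex X).Label) (vQ : Real.RatPlace),
          Set ((Real.logShells X logv Aut Ism hAut hIsm).Packet j vQ) → ℝ)
        (Ψ : ℤ → ∀ v : Real.Place F, v ∈ (Real.thetaIndex X).Vbad →
          Set ((Real.logShells X logv Aut Ism hAut hIsm).StarPacket v))
        (act : ℤ → ∀ v : Real.Place F, v ∈ (Real.thetaIndex X).Vbad →
          (Real.logShells X logv Aut Ism hAut hIsm).StarPacket v →
            Module.End ℚ ((Real.logShells X logv Aut Ism hAut hIsm).StarPacket v))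
        (Mmod : ℤ → ∀ j : (Real.thetaIndex X).LabelStar,
          Set ((Real.logShells X logv Aut Ism hAut hIsm).GlobalPacket j.1))
        (region : ℤ → ∀ j : (Real.thetaIndex X).LabelStar,
          FinDivisor F → ∀ vQ : Real.RatPlace, Set ((Real.logShells X logv Aut Ism hAut hIsm).Packet j.1 vQ))
        (P : SettingReal X logv Aut Ism hAut hIsm archPk archSub Adm logvol Ψ act Mmod region),
        StatementReal X logv Aut Ism hAut hIsm archPk archSub Adm logvol Ψ act Mmod region P := by
  intro hall
  obtain ⟨X, -⟩ := ValLine.exists_pilotData_rat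
  obtain ⟨P, hP⟩ := Cor312.Setting.exists_setting_not_statement
    (Real.situation X (fun _ => 0) (fun _ => Set.univ) (fun _ => Set.univ) (fun _ => Set.mem_univ _)
      (fun _ => Set.mem_univ _) (fun _ _ => ∅) (fun _ _ => ∅) (fun _ _ _ => True) (fun _ _ _ => 0)
      (fun _ _ _ => ∅) (fun _ _ _ _ => 0) (fun _ _ => ∅) (fun _ _ _ _ => ∅))
    (fun _ _ => trivial) (fun _ _ => rfl)
  exact hP (hall ℚ X _ _ _ _ _ _ _ _ _ _ _ _ _ P)

/-- **F-2147, INHABITED**: at the same real situation over `ℚ` the junk setting of `exists_setting_statement` satisfies the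
verbatim statement (both printed quantities are the procession-normalised sum of `logvol univ = 0`).
[claim: Mochizuki2012, status: disputed] -/
theorem exists_statementReal :
    ∃ (F : Type) (_ : Field F) (_ : NumberField F) (X : PilotData F) (logv : Real.PadicLogs F)
        (Aut Ism : ∀ x : Real.Place F, Set (Real.Carrier x ≃ₗ[ℚ] Real.Carrier x))
        (hAut : ∀ x, LinearEquiv.refl ℚ (Real.Carrier x) ∈ Aut x)
        (hIsm : ∀ x, LinearEquiv.refl ℚ (Real.Carrier x) ∈ Ism x)
        (archPk : ∀ (j : (Real.thetaIndex X).Label) (vQ : Real.RatPlace),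
          Set ((Real.logShells X logv Aut Ism hAut hIsm).Packet j vQ))
        (archSub : ∀ (j : (Real.thetaIndex X).Label) (v : Real.Place F),
          Set ((Real.logShells X logv Aut Ism hAut hIsm).Packet j ((Real.thetaIndex X).over v)))
        (Adm : ∀ (j : (Real.thetaIndex X).Label) (vQ : Real.RatPlace),
          Set ((Real.logShells X logv Aut Ism hAut hIsm).Packet j vQ) → Prop)
        (logvol : ∀ (j : (Real.thetaIndex X).Label) (vQ : Real.RatPlace),
          Set ((Real.logShells X logv Aut Ism hAut hIsm).Packet j vQ) → ℝ)
        (Ψ : ℤ → ∀ v : Real.Place F, v ∈ (Real.thetaIndex X).Vbad →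
          Set ((Real.logShells X logv Aut Ism hAut hIsm).StarPacket v))
        (act : ℤ → ∀ v : Real.Place F, v ∈ (Real.thetaIndex X).Vbad →
          (Real.logShells X logv Aut Ism hAut hIsm).StarPacket v →
            Module.End ℚ ((Real.logShells X logv Aut Ism hAut hIsm).StarPacket v))
        (Mmod : ℤ → ∀ j : (Real.thetaIndex X).LabelStar,
          Set ((Real.logShells X logv Aut Ism hAut hIsm).GlobalPacket j.1))
        (region : ℤ → ∀ j : (Real.thetaIndex X).LabelStar,
          FinDivisor F → ∀ vQ : Real.RatPlace, Set ((Real.logShells X logv Aut Ism hAut hIsm).Packet j.1 vQ))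
        (P : SettingReal X logv Aut Ism hAut hIsm archPk archSub Adm logvol Ψ act Mmod region),
        StatementReal X logv Aut Ism hAut hIsm archPk archSub Adm logvol Ψ act Mmod region P := by
  obtain ⟨X, -⟩ := ValLine.exists_pilotData_rat
  obtain ⟨P, hP⟩ := Cor312.Setting.exists_setting_statement
    (Real.situation X (fun _ => 0) (fun _ => Set.univ) (fun _ => Set.univ) (fun _ => Set.mem_univ _)
      (fun _ => Set.mem_univ _) (fun _ _ => ∅) (fun _ _ => ∅) (fun _ _ _ => True) (fun _ _ _ => 0)
      (fun _ _ _ => ∅) (fun _ _ _ _ => 0) (fun _ _ => ∅) (fun _ _ _ _ => ∅))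
    (fun _ _ => trivial) (fun _ _ => rfl)
  exact ⟨ℚ, inferInstance, inferInstance, X, _, _, _, _, _, _, _, _, _, _, _, _, _, P, hP⟩

/-- **F-2148, ∀-closure REFUTED**: the same over the real carriers with Dupuy–Hilado's (Ind1)/(Ind2) slots
(`situationDH`): pilot data over `ℚ`, zero log branches, `Adm := ⊤`, `logvol := 0`, empty (b)/(c) data.
[claim: Mochizuki2012, status: disputed] -/
theorem not_forall_statementRealDH :
    ¬ ∀ (F : Type) [Field F] [NumberField F] (X : PilotData F) (logv : Real.PadicLogs F)
        (archPk : ∀ (j : (Real.thetaIndex X).Label) (vQ : Real.RatPlace), Set ((Real.logShellsDH X logv).Packet j vQ))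
        (archSub : ∀ (j : (Real.thetaIndex X).Label) (v : Real.Place F),
          Set ((Real.logShellsDH X logv).Packet j ((Real.thetaIndex X).over v)))
        (Adm : ∀ (j : (Real.thetaIndex X).Label) (vQ : Real.RatPlace), Set ((Real.logShellsDH X logv).Packet j vQ) → Prop)
        (logvol : ∀ (j : (Real.thetaIndex X).Label) (vQ : Real.RatPlace), Set ((Real.logShellsDH X logv).Packet j vQ) → ℝ)
        (Ψ : ℤ → ∀ v : Real.Place F, v ∈ (Real.thetaIndex X).Vbad → Set ((Real.logShellsDH X logv).StarPacket v))
        (act : ℤ → ∀ v : Real.Place F, v ∈ (Real.thetaIndex X).Vbad → (Real.logShellsDH X logv).StarPacket v →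
          Module.End ℚ ((Real.logShellsDH X logv).StarPacket v))
        (Mmod : ℤ → ∀ j : (Real.thetaIndex X).LabelStar, Set ((Real.logShellsDH X logv).GlobalPacket j.1))
        (region : ℤ → ∀ j : (Real.thetaIndex X).LabelStar,
          FinDivisor F → ∀ vQ : Real.RatPlace, Set ((Real.logShellsDH X logv).Packet j.1 vQ))
        (P : Setting (situationDH X logv archPk archSub Adm logvol Ψ act Mmod region)),
        StatementRealDH X logv archPk archSub Adm logvol Ψ act Mmod region P := by
  intro hall
  obtain ⟨X, -⟩ := ValLine.exists_pilotData_rat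
  obtain ⟨P, hP⟩ := Cor312.Setting.exists_setting_not_statement
    (situationDH X (fun _ => 0) (fun _ _ => ∅) (fun _ _ => ∅) (fun _ _ _ => True) (fun _ _ _ => 0)
      (fun _ _ _ => ∅) (fun _ _ _ _ => 0) (fun _ _ => ∅) (fun _ _ _ _ => ∅))
    (fun _ _ => trivial) (fun _ _ => rfl)
  exact hP (hall ℚ X _ _ _ _ _ _ _ _ _ P)

/-- **F-2148, INHABITED**: at the same Dupuy–Hilado-slot situation over `ℚ` the junk setting of `exists_setting_statement`
satisfies the verbatim statement. [claim: Mochizuki2012, status: disputed] -/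
theorem exists_statementRealDH :
    ∃ (F : Type) (_ : Field F) (_ : NumberField F) (X : PilotData F) (logv : Real.PadicLogs F)
        (archPk : ∀ (j : (Real.thetaIndex X).Label) (vQ : Real.RatPlace), Set ((Real.logShellsDH X logv).Packet j vQ))
        (archSub : ∀ (j : (Real.thetaIndex X).Label) (v : Real.Place F),
          Set ((Real.logShellsDH X logv).Packet j ((Real.thetaIndex X).over v)))
        (Adm : ∀ (j : (Real.thetaIndex X).Label) (vQ : Real.RatPlace), Set ((Real.logShellsDH X logv).Packet j vQ) → Prop)
        (logvol : ∀ (j : (Real.thetaIndex X).Label) (vQ : Real.RatPlace), Set ((Real.logShellsDH X logv).Packet j vQ) → ℝ)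
        (Ψ : ℤ → ∀ v : Real.Place F, v ∈ (Real.thetaIndex X).Vbad → Set ((Real.logShellsDH X logv).StarPacket v))
        (act : ℤ → ∀ v : Real.Place F, v ∈ (Real.thetaIndex X).Vbad → (Real.logShellsDH X logv).StarPacket v →
          Module.End ℚ ((Real.logShellsDH X logv).StarPacket v))
        (Mmod : ℤ → ∀ j : (Real.thetaIndex X).LabelStar, Set ((Real.logShellsDH X logv).GlobalPacket j.1))
        (region : ℤ → ∀ j : (Real.thetaIndex X).LabelStar,
          FinDivisor F → ∀ vQ : Real.RatPlace, Set ((Real.logShellsDH X logv).Packet j.1 vQ))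
        (P : Setting (situationDH X logv archPk archSub Adm logvol Ψ act Mmod region)),
        StatementRealDH X logv archPk archSub Adm logvol Ψ act Mmod region P := by
  obtain ⟨X, -⟩ := ValLine.exists_pilotData_rat
  obtain ⟨P, hP⟩ := Cor312.Setting.exists_setting_statement
    (situationDH X (fun _ => 0) (fun _ _ => ∅) (fun _ _ => ∅) (fun _ _ _ => True) (fun _ _ _ => 0)
      (fun _ _ _ => ∅) (fun _ _ _ _ => 0) (fun _ _ => ∅) (fun _ _ _ _ => ∅))
    (fun _ _ => trivial) (fun _ _ => rfl)
  exact ⟨ℚ, inferInstance, inferInstance, X, _, _, _, _, _, _, _, _, _, P, hP⟩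

end SchemaClosures

/-! ## F-2149 `Cor312.StatementRealM` — per-datum (no closed `InitialThetaData` is a junk object) -/

namespace SchemaClosures

open Cor312 Literature.IUT.HodgeTheaters

variable {F : Type} [Field F] [NumberField F] {K Fbar : Type} [Field K] [NumberField K] [Algebra F K]
  [Field Fbar] [Algebra F Fbar] [Algebra K Fbar] {E : WeierstrassCurve F} [E.IsElliptic] {l : ℕ}
  {Pb : BadPlacePredicates K}

/-- **F-2149 at EVERY initial Θ-datum, negative instance**: over the M-level situation `situationM D …` (zero log
branches, all (Ind1)/(Ind2) slots `univ`, `Adm := ⊤`, `logvol := 0`, empty (b)/(c) data) the junk setting of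
`exists_setting_not_statement` violates the verbatim statement. So the ∀-closure of F-2149 is refuted as soon as ONE
`InitialThetaData` is exhibited (none is constructed in the tree; [IUTchI] Def. 3.1 data are genuine).
[claim: Mochizuki2012, status: disputed] -/
theorem exists_not_statementRealM (D : InitialThetaData F K Fbar E l Pb) :
    ∃ (S : Situation (Real.thetaIndexOfInitial D)) (P : Setting S), ¬ StatementRealM D P := by
  obtain ⟨P, hP⟩ := Cor312.Setting.exists_setting_not_statement
    (situationM D (fun _ => 0) (fun _ => Set.univ) (fun _ => Set.univ) (fun _ => Set.mem_univ _)
      (fun _ => Set.mem_univ _) (fun _ _ => ∅) (fun _ _ => ∅) (fun _ _ _ => True) (fun _ _ _ => 0)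
      (fun _ _ _ => ∅) (fun _ _ _ _ => 0) (fun _ _ => ∅) (fun _ _ _ _ => ∅))
    (fun _ _ => trivial) (fun _ _ => rfl)
  exact ⟨_, P, hP⟩

/-- **F-2149 at EVERY initial Θ-datum, positive instance**: over the same M-level situation the junk setting of
`exists_setting_statement` satisfies the verbatim statement. [claim: Mochizuki2012, status: disputed] -/
theorem exists_statementRealM (D : InitialThetaData F K Fbar E l Pb) :
    ∃ (S : Situation (Real.thetaIndexOfInitial D)) (P : Setting S), StatementRealM D P := by
  obtain ⟨P, hP⟩ := Cor312.Setting.exists_setting_statement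
    (situationM D (fun _ => 0) (fun _ => Set.univ) (fun _ => Set.univ) (fun _ => Set.mem_univ _)
      (fun _ => Set.mem_univ _) (fun _ _ => ∅) (fun _ _ => ∅) (fun _ _ _ => True) (fun _ _ _ => 0)
      (fun _ _ _ => ∅) (fun _ _ _ _ => 0) (fun _ _ => ∅) (fun _ _ _ _ => ∅))
    (fun _ _ => trivial) (fun _ _ => rfl)
  exact ⟨_, P, hP⟩

end SchemaClosures

end Summit.ABC.IUTFork

end
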